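import Summits.Schanuel.Schanuel.Theorems.SoloInformedDerivativeGcdRadical
import Summits.Schanuel.Schanuel.Theorems.SoloInformedRoyAdditiveGelfond
import Literature.NumberTheory.Transcendental.Roy2010.AdditiveSmallValueEstimates
import HarnessLib.Audit.Tags

/-!
# Solo-informed toy line: the radical of the dilated derivative-gcd (AE-2, steps (a), (c))

Packaging for THEOREM AE-2 (η = 0) of the seat's AE-note (§9), no new mathematics.  The pen
text divides `P` by `T^k` before dilating; in the kernel we keep the family built from `P`
itself (so that the small-value data of `RoyAdditiveSmall` applies verbatim) and strip the
power of `X` from the common divisor instead: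

* `P = X^k · P̃` with `P̃(0) ≠ 0` (`rootMultiplicity`), `‖P̃‖_∞ = ‖P‖_∞`,
  `deg P̃ ≤ deg P`; `(X^k P̃)(aT) = a^k · P̃(aT) · X^k`;
* if `Q` is primitive and divides `(P(aT))^{[j]}` for all `a ∈ A`, `j < t` (`t ≥ 1`), write
  `Q = X^e · Q̃` with `X ∤ Q̃`; then `Q̃` and `(radical Q̃)^t` divide the dilation-gcd
  `dilationGcd A P̃ = primPart (gcd_a P̃(aT))` of [Roy2010, Thm 1.2] (Euclid past `X^k`, Gauss
  past the constant `a^k`, and (R3) = `soloDG_radical_pow_dvd`);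
* consequences: `deg Q̃ ≤ deg (dilationGcd A P̃)`,
  `t · deg radical Q̃ ≤ deg (dilationGcd A P̃)`,
  `t · log M(radical Q̃) ≤ deg(dilationGcd A P̃)/2 + log ‖dilationGcd A P̃‖_∞`,
  the roots of `Q̃` are roots of its radical, and `‖Q̃(z)‖ ≤ ‖Q(z)‖ / m^n` when
  `m ≤ min(1, ‖z‖)`, `e ≤ n`.

With [Roy2010, Thm 1.2] (`Literature…Roy2010.thm_1_2`, a displayed hypothesis downstream)
bounding `deg` and `‖·‖_∞` of `dilationGcd (primesLe n^μ) P̃`, these give the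
degree / Mahler measure inputs `D₀, L₀` of `soloGS_structured_roots` /
`soloGG_gelfond_input` at the root-count scale `N = ⌊n^{1-μ+δ}⌋`.

References: [Roy2010] D. Roy, Small value estimates for the additive group, Int. J. Number
Theory 6 (2010), arXiv:0708.2307, Thm 1.2 and §9.
-/

namespace Summit.Schanuel.Schanuel.Theorems

open Polynomial Finset UniqueFactorizationMonoid
open Literature.NumberTheory.Transcendental.Roy2010 (dilationGcd)

/-! ### Part A. Stripping the power of `X` -/

/-- `P = X^k · P̃` with `P̃(0) ≠ 0` for a non-zero polynomial `P`. -/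
theorem soloDR_exists_X_pow_mul {P : ℤ[X]} (hP : P ≠ 0) :
    ∃ k : ℕ, ∃ Pt : ℤ[X], P = X ^ k * Pt ∧ Pt.coeff 0 ≠ 0 := by
  obtain ⟨q, hq, hndvd⟩ := P.exists_eq_pow_rootMultiplicity_mul_and_not_dvd hP 0
  refine ⟨P.rootMultiplicity 0, q, by simpa using hq, ?_⟩
  rw [map_zero, sub_zero, X_dvd_iff] at hndvd
  exact hndvd

/-- `P̃(0) ≠ 0` means `X ∤ P̃`. -/
theorem soloDR_not_X_dvd {Pt : ℤ[X]} (h : Pt.coeff 0 ≠ 0) : ¬ X ∣ Pt :=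
  fun hX => h (X_dvd_iff.mp hX)

/-- The cofactor is non-zero. -/
theorem soloDR_right_ne_zero {P Pt : ℤ[X]} {k : ℕ} (hP : P ≠ 0) (h : P = X ^ k * Pt) :
    Pt ≠ 0 := by
  rintro rfl
  exact hP (by rw [h, mul_zero])

/-- Degree bookkeeping: `deg P = k + deg P̃`. -/
theorem soloDR_natDegree_eq {P Pt : ℤ[X]} {k : ℕ} (hP : P ≠ 0) (h : P = X ^ k * Pt) :
    P.natDegree = k + Pt.natDegree := by
  rw [h, natDegree_mul (pow_ne_zero _ X_ne_zero) (soloDR_right_ne_zero hP h), natDegree_X_pow]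

/-- Multiplying by `X^k` does not change the sup norm. -/
theorem soloDR_supNorm_X_pow_mul (G : ℤ[X]) (k : ℕ) : (X ^ k * G).supNorm = G.supNorm := by
  apply le_antisymm
  · obtain ⟨i, hi⟩ := (X ^ k * G).exists_eq_supNorm
    rw [hi, coeff_X_pow_mul']
    split_ifs
    · exact G.le_supNorm _
    · rw [norm_zero]
      exact G.supNorm_nonneg
  · obtain ⟨i, hi⟩ := G.exists_eq_supNorm
    rw [hi, ← coeff_X_pow_mul G k i]
    exact (X ^ k * G).le_supNorm _

/-- Hence `‖P̃‖_∞ ≤ polyHeight P`. -/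
theorem soloDR_supNorm_le_polyHeight {P Pt : ℤ[X]} {k : ℕ} (h : P = X ^ k * Pt) :
    Pt.supNorm ≤ (polyHeight P : ℝ) := by
  rw [← soloDR_supNorm_X_pow_mul Pt k, ← h]
  exact supNorm_le_polyHeight P

/-- Dilating `X^k · P̃`: `(X^k P̃)(aT) = (a^k · P̃(aT)) · X^k`. -/
theorem soloDR_comp_X_pow_mul (Pt : ℤ[X]) (k : ℕ) (a : ℤ) :
    (X ^ k * Pt).comp (C a * X) = (C (a ^ k) * Pt.comp (C a * X)) * X ^ k := by
  rw [mul_comp, X_pow_comp, mul_pow, ← C_pow]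
  ring

/-! ### Part B. Euclid past `X^k`, Gauss past the constant -/

/-- If `X ∤ D` and `D ∣ M · X^k` then `D ∣ M` (`X` is prime in `ℤ[X]`). -/
theorem soloDR_dvd_of_dvd_mul_X_pow {D M : ℤ[X]} (hD0 : D ≠ 0) (hX : ¬ X ∣ D) {k : ℕ}
    (h : D ∣ M * X ^ k) : D ∣ M := by
  refine dvd_of_dvd_mul_left_of_no_prime_factors hD0 ?_ h
  intro d hdD hdX hd
  have hdX' : d ∣ X := hd.dvd_of_dvd_pow hdX
  exact hX (dvd_trans (hd.irreducible.dvd_symm prime_X.irreducible hdX') hdD)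

/-- If `D` is primitive and `D ∣ c · G` with `c ≠ 0`, `G ≠ 0`, then `D ∣ G`. -/
theorem soloDR_dvd_of_dvd_C_mul {D G : ℤ[X]} (hD : D.IsPrimitive) {c : ℤ} (hc : c ≠ 0)
    (hG0 : G ≠ 0) (h : D ∣ C c * G) : D ∣ G := by
  have h0 : C c * G ≠ 0 := mul_ne_zero (C_ne_zero.mpr hc) hG0
  have h1 : D ∣ (C c * G).primPart := (hD.dvd_primPart_iff_dvd h0).mpr h
  rw [primPart_mul h0] at h1
  have h2 : D ∣ G.primPart := (isUnit_primPart_C c).dvd_mul_left.mp h1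
  exact h2.trans (primPart_dvd G)

/-- Combination: `X ∤ D`, `D` primitive, `D ∣ (X^k P̃)(aT)` with `a ≠ 0`, `P̃ ≠ 0` give
`D ∣ P̃(aT)`. -/
theorem soloDR_dvd_comp_of_dvd_comp {D Pt : ℤ[X]} (hD0 : D ≠ 0) (hD : D.IsPrimitive)
    (hX : ¬ X ∣ D) (hPt : Pt ≠ 0) {k : ℕ} {a : ℤ} (ha : a ≠ 0)
    (h : D ∣ (X ^ k * Pt).comp (C a * X)) : D ∣ Pt.comp (C a * X) := by
  rw [soloDR_comp_X_pow_mul] at h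
  have h1 := soloDR_dvd_of_dvd_mul_X_pow hD0 hX h
  have hG0 : Pt.comp (C a * X) ≠ 0 :=
    fun h0 => hPt ((comp_C_mul_X_eq_zero_iff (mem_nonZeroDivisors_of_ne_zero ha)).mp h0)
  exact soloDR_dvd_of_dvd_C_mul hD (pow_ne_zero _ ha) hG0 h1

/-! ### Part C. The stripped common divisor and its radical divide the dilation-gcd -/

/-- The gcd of the dilates `P̃(aT)`, `a ∈ A`, is non-zero as soon as `A` contains a non-zero
element and `P̃ ≠ 0`. -/
theorem soloDR_gcd_ne_zero {Pt : ℤ[X]} (hPt : Pt ≠ 0) {A : Finset ℕ} {a₀ : ℕ}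
    (ha₀ : a₀ ∈ A) (ha₀0 : a₀ ≠ 0) : (A.gcd fun a : ℕ => Pt.comp (C (a : ℤ) * X)) ≠ 0 := by
  intro h
  rw [Finset.gcd_eq_zero_iff] at h
  have h1 := h a₀ ha₀
  exact hPt ((comp_C_mul_X_eq_zero_iff
    (mem_nonZeroDivisors_of_ne_zero (by exact_mod_cast ha₀0))).mp h1)

/-- A primitive `D` with `X ∤ D` dividing every `(X^k P̃)(aT)`, `a ∈ A` (all `a ≠ 0`,
`A` non-empty), divides `dilationGcd A P̃`. -/
theorem soloDR_dvd_dilationGcd {D Pt : ℤ[X]} (hD0 : D ≠ 0) (hD : D.IsPrimitive)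
    (hX : ¬ X ∣ D) (hPt : Pt ≠ 0) {k : ℕ} {A : Finset ℕ} (hA : ∀ a ∈ A, a ≠ 0)
    {a₀ : ℕ} (ha₀ : a₀ ∈ A)
    (h : ∀ a ∈ A, D ∣ (X ^ k * Pt).comp (C (a : ℤ) * X)) : D ∣ dilationGcd A Pt := by
  have hg : D ∣ A.gcd fun a : ℕ => Pt.comp (C (a : ℤ) * X) := by
    refine Finset.dvd_gcd ?_
    intro a ha
    exact soloDR_dvd_comp_of_dvd_comp hD0 hD hX hPt (by exact_mod_cast hA a ha) (h a ha)
  unfold dilationGcd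
  exact (hD.dvd_primPart_iff_dvd (soloDR_gcd_ne_zero hPt ha₀ (hA a₀ ha₀))).mpr hg

/-- **The stripped divisor.** Let `Q` be primitive and non-zero with `Q ∣ (P(aT))^{[j]}`
for all `a ∈ A` and `j < t` (`t ≥ 1`), where `P = X^k P̃ ≠ 0` and `A` is a non-empty set of
non-zero naturals (`P̃(0) ≠ 0` is needed only later, for [Roy2010, Thm 1.2]).  Then
`Q = X^e · Q̃` with `Q̃ ≠ 0` primitive, `X ∤ Q̃`, `e ≤ deg Q`, and both `Q̃` and
`(radical Q̃)^t` divide `dilationGcd A P̃`. -/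
theorem soloDR_strip {P Pt Q : ℤ[X]} {k : ℕ} (hP : P ≠ 0) (hPk : P = X ^ k * Pt)
    (hQ0 : Q ≠ 0) (hQ : Q.IsPrimitive) {A : Finset ℕ}
    (hA : ∀ a ∈ A, a ≠ 0) {a₀ : ℕ} (ha₀ : a₀ ∈ A) {t : ℕ} (ht : 1 ≤ t)
    (hdvd : ∀ a ∈ A, ∀ j < t, Q ∣ hasseDeriv j (P.comp (C (a : ℤ) * X))) :
    ∃ e : ℕ, ∃ Qt : ℤ[X], Q = X ^ e * Qt ∧ Qt ≠ 0 ∧ Qt.IsPrimitive ∧ ¬ X ∣ Qt ∧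
      e ≤ Q.natDegree ∧ Qt ∣ dilationGcd A Pt ∧ radical Qt ^ t ∣ dilationGcd A Pt := by
  obtain ⟨e, Qt, hQe, hQt0c⟩ := soloDR_exists_X_pow_mul hQ0
  have hQt0 : Qt ≠ 0 := soloDR_right_ne_zero hQ0 hQe
  have hQtprim : Qt.IsPrimitive := isPrimitive_of_dvd hQ (Dvd.intro_left _ hQe.symm)
  have hXQt : ¬ X ∣ Qt := soloDR_not_X_dvd hQt0c
  have hPt : Pt ≠ 0 := soloDR_right_ne_zero hP hPk
  have hQtQ : Qt ∣ Q := Dvd.intro_left _ hQe.symm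
  refine ⟨e, Qt, hQe, hQt0, hQtprim, hXQt, ?_, ?_, ?_⟩
  · rw [soloDR_natDegree_eq hQ0 hQe]
    exact Nat.le_add_right _ _
  · refine soloDR_dvd_dilationGcd (k := k) hQt0 hQtprim hXQt hPt hA ha₀ ?_
    intro a ha
    have h1 := hdvd a ha 0 (by omega)
    rw [hasseDeriv_zero', hPk] at h1
    exact hQtQ.trans h1
  · have hR0 : radical Qt ^ t ≠ 0 := pow_ne_zero _ radical_ne_zero
    have hRprim : (radical Qt ^ t).IsPrimitive :=
      soloDG_isPrimitive_pow
        (isPrimitive_of_dvd hQtprim (radical_dvd_self : radical Qt ∣ Qt)) t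
    have hXR : ¬ X ∣ radical Qt ^ t := by
      intro hXd
      exact hXQt ((prime_X.dvd_of_dvd_pow hXd).trans (radical_dvd_self : radical Qt ∣ Qt))
    refine soloDR_dvd_dilationGcd (k := k) hR0 hRprim hXR hPt hA ha₀ ?_
    intro a ha
    rw [← hPk]
    exact soloDG_radical_pow_dvd hQtprim fun j hj => hQtQ.trans (hdvd a ha j hj)

/-! ### Part D. Degrees, Mahler measures, values -/

/-- `dilationGcd A P̃ ≠ 0` (it is a primitive part). -/
theorem soloDR_dilationGcd_ne_zero (A : Finset ℕ) (Pt : ℤ[X]) : dilationGcd A Pt ≠ 0 := by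
  unfold dilationGcd
  exact primPart_ne_zero _

/-- Degree of a divisor: `deg Q̃ ≤ deg (dilationGcd A P̃)`. -/
theorem soloDR_natDegree_le_of_dvd {Qt : ℤ[X]} {A : Finset ℕ} {Pt : ℤ[X]}
    (h : Qt ∣ dilationGcd A Pt) : Qt.natDegree ≤ (dilationGcd A Pt).natDegree :=
  natDegree_le_of_dvd h (soloDR_dilationGcd_ne_zero A Pt)

/-- Degree of the radical: `t · deg R ≤ deg G` when `R^t ∣ G ≠ 0`. -/
theorem soloDR_mul_natDegree_le {R G : ℤ[X]} {t : ℕ} (h : R ^ t ∣ G) (hG : G ≠ 0) :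
    t * R.natDegree ≤ G.natDegree := by
  have h1 := natDegree_le_of_dvd h hG
  rwa [natDegree_pow] at h1

/-- Mahler measure of the radical: `t · log M(R) ≤ deg G / 2 + log ‖G‖_∞` when
`R^t ∣ G ≠ 0` (`M` is multiplicative, the cofactor has `M ≥ 1`, and `M(G) ≤ √(deg G + 1) ‖G‖_∞ ≤
e^{deg G/2} ‖G‖_∞`). -/
theorem soloDR_mul_log_mahlerMeasure_le {R G : ℤ[X]} {t : ℕ} (h : R ^ t ∣ G) (hG : G ≠ 0) :
    t * Real.log (R.map (Int.castRingHom ℂ)).mahlerMeasure ≤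
      G.natDegree / 2 + Real.log G.supNorm := by
  have h1 := Polynomial.logMahlerMeasure_map_le_of_dvd hG h
  have h2 := Polynomial.logMahlerMeasure_map_le_half hG
  rw [Polynomial.map_pow, Polynomial.logMahlerMeasure_eq_log_MahlerMeasure,
    soloDG_mahlerMeasure_pow, Real.log_pow] at h1
  exact h1.trans h2

/-- Roots of `Q̃` are roots of its radical. -/
theorem soloDR_aeval_radical_eq_zero {Qt : ℤ[X]} (hQt0 : Qt ≠ 0) (z : ℂ)
    (hz : aeval z Qt = 0) : aeval z (radical Qt) = 0 :=
  soloDG_aeval_radical_eq_zero hQt0 hz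

/-- Values of the stripped divisor: if `Q = X^e Q̃`, `e ≤ n`, `0 < m ≤ 1` and `m ≤ ‖z‖`
then `‖Q̃(z)‖ ≤ ‖Q(z)‖ / m^n`. -/
theorem soloDR_norm_aeval_strip_le {Q Qt : ℤ[X]} {e n : ℕ} (hQe : Q = X ^ e * Qt)
    (hen : e ≤ n) {m : ℝ} (hm0 : 0 < m) (hm1 : m ≤ 1) {z : ℂ} (hz : m ≤ ‖z‖) :
    ‖aeval z Qt‖ ≤ ‖aeval z Q‖ / m ^ n := by
  have hmn : 0 < m ^ n := pow_pos hm0 n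
  rw [le_div_iff₀ hmn, hQe, map_mul, map_pow, aeval_X, norm_mul, norm_pow, mul_comm]
  have h1 : m ^ n ≤ m ^ e := pow_le_pow_of_le_one hm0.le hm1 hen
  have h2 : m ^ e ≤ ‖z‖ ^ e := pow_le_pow_left₀ hm0.le hz e
  exact mul_le_mul_of_nonneg_right (h1.trans h2) (norm_nonneg _)

/-- **Numeric package for AE-2.** From the stripped divisor and bounds `deg G ≤ Dg`,
`‖G‖_∞ ≤ exp Lg` for `G = dilationGcd A P̃` (the output of [Roy2010, Thm 1.2]), `t ≥ 1`:
`deg Q̃ ≤ Dg`, `deg (radical Q̃) ≤ Dg / t` and `log M(radical Q̃) ≤ (Dg/2 + Lg) / t`. -/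
theorem soloDR_bounds {Qt : ℤ[X]} {A : Finset ℕ} {Pt : ℤ[X]} {t : ℕ} (ht : 1 ≤ t)
    (hQt : Qt ∣ dilationGcd A Pt) (hR : radical Qt ^ t ∣ dilationGcd A Pt) {Dg Lg : ℝ}
    (hDg : ((dilationGcd A Pt).natDegree : ℝ) ≤ Dg)
    (hLg : (dilationGcd A Pt).supNorm ≤ Real.exp Lg) :
    (Qt.natDegree : ℝ) ≤ Dg ∧ ((radical Qt).natDegree : ℝ) ≤ Dg / t ∧
      Real.log ((radical Qt).map (Int.castRingHom ℂ)).mahlerMeasure ≤ (Dg / 2 + Lg) / t := by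
  have hG0 := soloDR_dilationGcd_ne_zero A Pt
  have ht0 : (0 : ℝ) < t := by exact_mod_cast ht
  refine ⟨?_, ?_, ?_⟩
  · exact le_trans (by exact_mod_cast soloDR_natDegree_le_of_dvd hQt) hDg
  · rw [le_div_iff₀ ht0, mul_comm]
    exact le_trans (by exact_mod_cast soloDR_mul_natDegree_le hR hG0) hDg
  · rw [le_div_iff₀ ht0, mul_comm]
    have h1 := soloDR_mul_log_mahlerMeasure_le hR hG0
    have hsup : Real.log (dilationGcd A Pt).supNorm ≤ Lg := by
      have h1s : 1 ≤ (dilationGcd A Pt).supNorm := Polynomial.one_le_supNorm_of_ne_zero hG0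
      rw [Real.log_le_iff_le_exp (by linarith)]
      exact hLg
    linarith

end Summit.Schanuel.Schanuel.Theorems
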